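/-
b2b-lace packet, CARVER gen 24 (unit `b2b-lace-carver-g24`).  ADDITIVE: no file of record is touched; imports
`NobleBoundsNGrouped` unchanged (and through it `NobleJointNLevel`, `NobleNestedXi`, `NobleBoundsNCover`).
-/
import Literature.Probability.FitznerVanDerHofstad2017.NobleBoundsNGrouped
import HarnessLib

/-!
# The NoBLE memory of the pivotal bonds at the chain sum: the ADMISSIBLE cover of (4.66)

CITATION HEADER (PLACEMENT v11). This module is part of a certified REPRODUCTION of:
R. Fitzner, R. van der Hofstad, *Mean-field behavior for nearest-neighbor percolation in `d > 10`*,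
Electron. J. Probab. 22 (2017), no. 43, 1–65 [FvdH17] (arXiv:1506.07977; extended version = arXiv:1506.07977v1
[FvdH17-ext]), and *Generalized approach to the non-backtracking lace expansion*, Probab. Theory Related Fields 169
(2017), 1041–1119 [NoBLE17].  Reproduces: [FvdH17] §3.3 (3.25)–(3.27), (3.31) — the NoBLE nesting with memory
`(B(b̲_{i-1}), {b̲_{i-1}})`: at every inner level the indicator `{b̄_i ∉ C̃_i ∪ {b̲_{i-1}}}` (the adjoined vertex is
part of the forbidden set of the top of the next pivotal bond), carried to the measure step (4.66) p. 43 ("the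
summation is over … b⃗ = (b_0,…,b_{N-1})": the summand vanishes unless `b̄_i ≠ b̲_{i-1}` for every `i ≥ 1`).
Origin: build `lace`, seat carver (gen 24), node Q-K2 (a3) (the coincidence question of the K2 design,
`HOME/lean1-g16/K2-DESIGN-MEMO.md` §2.4 (O1)).

WHAT THIS MODULE DOES.  The landed measure step `NobleJointNLevel.nobleXiT_succ_succ_le_cover` bounds
`Ξ̂^{(M+2)}_p(x)` by `Σ_{b⃗,w⃗,t⃗,z⃗} (∏J) ℙ^{⊗(M+3)}(⋃_{s,σ} W(s,σ,b⃗,w⃗,t⃗,z⃗;x))` over ALL bond vectors `b⃗`, and its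
cover `exists_mem_jointWitN` keeps `b̄_i ∉ {v_i,t_i,z_i,w_i,z_{i+1}}` (`LvView.NotC`) but not `b̄_i ≠ b̲_{i-1}`.  The exact
nested event `NobleNestedXi.nestXi` does carry it: its level-`i` cell is
`nobleCell (B(b̲_{i-1})) {b̲_{i-1}} (C̃_{i-1} ∪ …) b̄_{i-1} b̲_i b̄_i`, whose second clause reads
`b̄_i ∉ C̃^{b_i}(b̄_{i-1}) ∪ {b̲_{i-1}}`.  We extract the parameter-level consequence
`PivAdm n b⃗ := ∀ i, (b_{i+1}).2 ≠ (b_i).1` ("no pivotal bond returns to the vacant vertex of its own level";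
`pivAdm_of_mem_nestXi`), intersect the covering events with it (`jwCoverEAdm`), and re-run the eight-line measure
step: `nobleXiT_succ_succ_le_jwCoverEAdm` is `h1` of `NobleBoundsNCover.nobleXiT_le_recP_chain_of_cover` for the
admissible cover, `jwCoverEAdm_subset_iUnion_jwCoverC` its `hC`, and `nobleXiT_le_recP_chain_of_jointWit_adm` the
chain assembly in which the class estimates `h2` are owed ONLY for admissible `b⃗` (transfer lemma
`mul_piPerc_jwCoverEAdm_inter_le`).  Junction form for the letter packages: under `PivAdm`, the pivotal bond `b_{k+1}`
is never the reversed exit bond `(w_k, b̲_k)` of the level below (`PivAdm.bond_succ_ne_exit`,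
`bond_succ_ne_exit_of_mem_jwPiece`), and it is not a vacant bond of that level, `b_{k+1} ∉ B(b̲_k)`
(`bond_succ_notMem_bondsAt_of_mem_jwPiece`).

SCOPE.  Exact statements, any `d`, any `p`; no numeral of record moves; no sentence about any particular dimension.
Nothing in `NobleJointNLevel`, `NobleNestedXi`, `NobleBoundsNCover`, `NobleBoundsNGrouped` is modified; the landed
(all-`b⃗`) cover and chain theorems remain available unchanged.

[cite: FitznerVanDerHofstad2017, §3.3 (3.25)–(3.27), (3.31) (arXiv:1506.07977v2 pp. 25–27); (4.66) (p. 43); §6.1 (6.4) (p. 58)]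
[cite: FitznerVanDerHofstad2016NoBLE, §1.2 (the non-backtracking memory of the expansion)]
[cite: GrimmettPercolation1999, §1.3 p. 10 (product measure)]
-/

noncomputable section

namespace Literature.Probability.FitznerVanDerHofstad2017

open Literature.Barriers.CriticalPhenomena Literature.Probability.Percolation
open Literature.Probability.LatticeModels Literature.Combinatorics.SimpleGraph _root_.SimpleGraph
open _root_.MeasureTheory
open Literature.Probability.FitznerVanDerHofstad2017.NobleBlocks (piPerc)
open Literature.Probability.FitznerVanDerHofstad2017.BlockSummation
open scoped BigOperators ENNReal

variable {d : ℕ}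

/-! ### A. The admissibility predicate and its extraction from the exact nested event -/

/-- **Pivotal admissibility** of a bond vector `b⃗ = (b_0,…,b_n)` (`b_i = (b̲_i, b̄_i)`): the top `b̄_{i+1}` of each
pivotal bond is not the vacant vertex `b̲_i` of its own level — the NoBLE memory `b̄_{i+1} ∉ C̃_{i+1} ∪ {b̲_i}`, read on
the parameters. [cite: FitznerVanDerHofstad2017, (3.25)–(3.27) "u′ ∉ C̃^{(u,u′)}(v) ∪ A′" with A′ = {b̲_{i-1}} (arXiv:1506.07977v2 pp. 25–26)] -/
def PivAdm (n : ℕ) (b : Fin (n + 1) → Site d × Site d) : Prop :=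
  ∀ i : Fin n, (b i.succ).2 ≠ (b i.castSucc).1

/-- A single bond is admissible (no inner level). [cite: FitznerVanDerHofstad2017, (3.31) (arXiv:1506.07977v2 p. 27)] -/
theorem pivAdm_zero (b : Fin 1 → Site d × Site d) : PivAdm 0 b := fun i => i.elim0

/-- **Extraction.**  On the exact nested event with outer data `(B, A′)`, the top of the first pivotal bond avoids
`A′` and the bond vector is admissible. [cite: FitznerVanDerHofstad2017, (3.25)–(3.27), (3.31) (arXiv:1506.07977v2 pp. 25–27)] -/
theorem snd_notMem_and_pivAdm_of_mem_nestXi :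
    ∀ (n : ℕ) (B : Set (Sym2 (Site d))) (A' A : Set (Site d)) (v : Site d) (b : Fin (n + 1) → Site d × Site d)
      (x : Site d) (ω : Fin (n + 2) → BondConfig (Site d)),
      ω ∈ nestXi n B A' A v b x → (b 0).2 ∉ A' ∧ PivAdm n b
  | 0, B, A', A, v, b, x, ω, h => by
    rw [mem_nestXi_zero_iff] at h
    exact ⟨fun ha => h.1.2 (Set.mem_union_right _ ha), fun i => i.elim0⟩
  | n + 1, B, A', A, v, b, x, ω, h => by
    rw [mem_nestXi_succ_iff] at h
    obtain ⟨h0, htail⟩ := h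
    have ih := snd_notMem_and_pivAdm_of_mem_nestXi n _ _ _ _ _ _ _ htail
    refine ⟨fun ha => h0.2 (Set.mem_union_right _ ha), fun i => ?_⟩
    refine Fin.cases ?_ (fun j => ?_) i
    · have h1 : ((fun i : Fin (n + 1) => b i.succ) 0).2 ∉ ({(b 0).1} : Set (Site d)) := ih.1
      simpa using h1
    · have h2 := ih.2 j
      simp only at h2
      rw [← Fin.succ_castSucc]
      exact h2

/-- **The bond vector of `Ξ^{(n+1)}(x)` is admissible** on its exact nested event.
[cite: FitznerVanDerHofstad2017, (3.31), (3.43) (arXiv:1506.07977v2 pp. 27–28)] -/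
theorem pivAdm_of_mem_nestXi {n : ℕ} {b : Fin (n + 1) → Site d × Site d} {x : Site d}
    {ω : Fin (n + 2) → BondConfig (Site d)} (h : ω ∈ nestXi n ∅ ∅ {0} 0 b x) : PivAdm n b :=
  (snd_notMem_and_pivAdm_of_mem_nestXi n ∅ ∅ {0} 0 b x ω h).2

/-! ### B. The admissible cover -/

/-- **The admissible covering events** `E^{adm}(b⃗,w⃗,t⃗,z⃗) = 𝟙{PivAdm b⃗} · E(b⃗,w⃗,t⃗,z⃗)`.
[cite: FitznerVanDerHofstad2017, (4.66) (arXiv:1506.07977v2 p. 43)] -/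
def jwCoverEAdm (M : ℕ) (x : Site d) (b : Fin (M + 2) → Site d × Site d) (w t z : Fin (M + 2) → Site d) :
    Set (Fin (M + 3) → BondConfig (Site d)) :=
  {ω | PivAdm (M + 1) b ∧ ω ∈ jwCoverE M x b w t z}

section Cover

variable (M : ℕ) (x : Site d) (b : Fin (M + 2) → Site d × Site d) (w t z : Fin (M + 2) → Site d)

/-- Unfolding lemma for the admissible cover of (4.66). [cite: FitznerVanDerHofstad2017, (4.66) (arXiv:1506.07977v2 p. 43)] -/
theorem mem_jwCoverEAdm_iff {ω : Fin (M + 3) → BondConfig (Site d)} :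
    ω ∈ jwCoverEAdm M x b w t z ↔ PivAdm (M + 1) b ∧ ω ∈ jwCoverE M x b w t z :=
  Iff.rfl

/-- `E^{adm} ⊆ E`: the admissible cover refines the cover of (4.66). [cite: FitznerVanDerHofstad2017, (4.66) (arXiv:1506.07977v2 p. 43)] -/
theorem jwCoverEAdm_subset : jwCoverEAdm M x b w t z ⊆ jwCoverE M x b w t z := fun _ h => h.2

/-- On an admissible bond vector the two covers of (4.66) agree. [cite: FitznerVanDerHofstad2017, (4.66) (arXiv:1506.07977v2 p. 43)] -/
theorem jwCoverEAdm_eq_of_pivAdm (h : PivAdm (M + 1) b) : jwCoverEAdm M x b w t z = jwCoverE M x b w t z :=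
  Set.ext fun _ => ⟨fun h' => h'.2, fun h' => ⟨h, h'⟩⟩

/-- Off the admissible bond vectors the admissible cover of (4.66) is empty (the summand vanishes). [cite: FitznerVanDerHofstad2017, (4.66) (arXiv:1506.07977v2 p. 43)] -/
theorem jwCoverEAdm_eq_empty (h : ¬ PivAdm (M + 1) b) : jwCoverEAdm M x b w t z = ∅ :=
  Set.eq_empty_iff_forall_notMem.2 fun _ h' => h h'.1

/-- A configuration of the admissible cover of (4.66) certifies admissibility. [cite: FitznerVanDerHofstad2017, (4.66) (arXiv:1506.07977v2 p. 43)] -/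
theorem pivAdm_of_mem_jwCoverEAdm {ω : Fin (M + 3) → BondConfig (Site d)} (h : ω ∈ jwCoverEAdm M x b w t z) :
    PivAdm (M + 1) b :=
  h.1

end Cover

/-- **`hC`** for the admissible cover of (4.66): it lies in the union of the class pieces of §6.1 (6.4).
[cite: FitznerVanDerHofstad2017, (4.66) p. 43 and §6.1 (6.4) p. 58 (arXiv:1506.07977v2)] -/
theorem jwCoverEAdm_subset_iUnion_jwCoverC (M : ℕ) (x : Site d) :
    ∀ (b : Fin (M + 2) → Site d × Site d) (w t z : Fin (M + 2) → Site d),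
      jwCoverEAdm M x b w t z ⊆ ⋃ a : Fin (M + 2) → Fin 3 ⊕ Unit, ⋃ c : Fin 3 ⊕ Unit, jwCoverC M x b w t z a c :=
  fun b w t z => (jwCoverEAdm_subset M x b w t z).trans (jwCoverE_subset_iUnion_jwCoverC M x b w t z)

/-! ### C. The measure step of (4.66) with the admissible cover (`h1`) -/

/-- **THE MEASURE STEP of (4.66), ADMISSIBLE FORM**:
`Ξ̂^{(M+2)}_p(x) ≤ ∑_{b⃗} J(b⃗) ∑_{w⃗,t⃗,z⃗} ℙ_p^{⊗(M+3)}(𝟙{PivAdm b⃗} ⋃_{s,σ} W_{M+1}(s,σ,b⃗,w⃗,t⃗,z⃗;x))` — the landed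
`nobleXiT_succ_succ_le_cover` with the NoBLE memory of the pivotal bonds retained (the sum over non-admissible `b⃗`
vanishes). [cite: FitznerVanDerHofstad2017, (3.31) and (4.66) (arXiv:1506.07977v2 pp. 27, 43)] -/
theorem nobleXiT_succ_succ_le_cover_adm (p : unitInterval) (M : ℕ) (x : Site d) :
    nobleXiT d p (M + 2) x ≤ ∑' b : Fin (M + 2) → Site d × Site d, ∑' w : Fin (M + 2) → Site d,
      ∑' t : Fin (M + 2) → Site d, ∑' z : Fin (M + 2) → Site d,
        bondJProd d p b * piPerc d p (M + 3) (jwCoverEAdm M x b w t z) := by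
  rw [nobleXiT_succ_succ_eq_tsum]
  refine tsum_mul_piPerc_le_of_cover₃ p (bondJProd d p) (fun b => ∀ i, (zdGraph d).Adj 0 ((b i).2 - (b i).1))
    (fun b hb => by unfold bondJProd; exact prod_ofReal_bondJ_eq_zero_of_not_adj p hb) _
    (fun b w t z => jwCoverEAdm M x b w t z) fun b hb ω hω hlat => ?_
  have hb' : ∀ i, (b i).1 ≠ (b i).2 := fun i h => (hb i).ne (by rw [h, sub_self])
  have hω' : ω ∈ nestXi (M + 1) ∅ ∅ {0} 0 b x := hω
  obtain ⟨s, σ, w, t, z, hmem⟩ := exists_mem_jointWitN (M + 1) hlat hb' hω'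
  exact ⟨w, t, z, pivAdm_of_mem_nestXi hω', Set.mem_iUnion.2 ⟨s, Set.mem_iUnion.2 ⟨σ, hmem⟩⟩⟩

/-- **`h1`** in the consumer's shape (`NobleBoundsNCover.nobleXiT_le_recP_chain_of_cover`, `n = M + 1`) for the
admissible cover. [cite: FitznerVanDerHofstad2017, (4.66) (arXiv:1506.07977v2 p. 43)] -/
theorem nobleXiT_succ_succ_le_jwCoverEAdm (p : unitInterval) (M : ℕ) (x : Site d) :
    nobleXiT d p (M + 2) x ≤ ∑' b : Fin (M + 2) → Site d × Site d, ∑' w : Fin (M + 2) → Site d,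
      ∑' t : Fin (M + 2) → Site d, ∑' z : Fin (M + 2) → Site d,
        (∏ i, ENNReal.ofReal (bondJ d p ((b i).2 - (b i).1))) * piPerc d p (M + 3) (jwCoverEAdm M x b w t z) :=
  nobleXiT_succ_succ_le_cover_adm p M x

/-! ### D. Transfer of class estimates and the chain assembly with admissible `h2` -/

section Transfer

variable (p : unitInterval) (M : ℕ) (x : Site d) (b : Fin (M + 2) → Site d × Site d) (w t z : Fin (M + 2) → Site d)

/-- **Transfer.**  A class estimate of §6.1 (6.4) owed only for admissible `b⃗` is a class estimate for the
admissible cover of (4.66) (which is empty otherwise).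
[cite: FitznerVanDerHofstad2017, (4.66) p. 43 and §6.1 (6.4) p. 58 (arXiv:1506.07977v2)] -/
theorem mul_piPerc_jwCoverEAdm_inter_le (C : Set (Fin (M + 3) → BondConfig (Site d))) {J R : ℝ≥0∞}
    (h : PivAdm (M + 1) b → J * piPerc d p (M + 3) (jwCoverE M x b w t z ∩ C) ≤ R) :
    J * piPerc d p (M + 3) (jwCoverEAdm M x b w t z ∩ C) ≤ R := by
  by_cases hA : PivAdm (M + 1) b
  · rw [jwCoverEAdm_eq_of_pivAdm M x b w t z hA]
    exact h hA
  · rw [jwCoverEAdm_eq_empty M x b w t z hA, Set.empty_inter, measure_empty, mul_zero]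
    exact bot_le

/-- The admissible cover of (4.66) is dominated by the full cover, class piece by class piece.
[cite: FitznerVanDerHofstad2017, (4.66) p. 43 and §6.1 (6.4) p. 58 (arXiv:1506.07977v2)] -/
theorem piPerc_jwCoverEAdm_inter_le (C : Set (Fin (M + 3) → BondConfig (Site d))) :
    piPerc d p (M + 3) (jwCoverEAdm M x b w t z ∩ C) ≤ piPerc d p (M + 3) (jwCoverE M x b w t z ∩ C) :=
  measure_mono (Set.inter_subset_inter_left _ (jwCoverEAdm_subset M x b w t z))

end Transfer

/-- **`Ξ̂^{(M+2)}` THROUGH THE GENERIC CHAIN ASSEMBLY over `ι = Fin 3 ⊕ Unit`, ADMISSIBLE FORM**: the statement of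
`NobleJointNLevel.nobleXiT_le_recP_chain_of_jointWit` with the class estimates `h2` owed ONLY for pivotal-admissible
bond vectors `b⃗` (`PivAdm (M+1) b`: `b̄_{k+1} ≠ b̲_k` at every junction).
[cite: FitznerVanDerHofstad2017, (3.31) p. 27, (4.66) p. 43, §6.1 (6.4) p. 58, Lemma 6.1 (6.51) p. 66 (arXiv:1506.07977v2)] -/
theorem nobleXiT_le_recP_chain_of_jointWit_adm (p : unitInterval) (x : Site d) (M : ℕ)
    (S : Fin 3 ⊕ Unit → Site d → Site d → ℝ≥0∞)
    (B : (Fin d × Bool) → Fin 3 ⊕ Unit → Fin 3 ⊕ Unit → Site d → Site d → Site d → Site d → ℝ≥0∞)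
    (Bpt : (Fin d × Bool) → Fin 3 ⊕ Unit → Fin 3 ⊕ Unit → Site d → Site d → Site d → Site d → Site d →
      Site d → ℝ≥0∞)
    (hBpt : ∀ κ a a' u w w' u', ∑' t, ∑' z, Bpt κ a a' u w t z w' u' ≤ B κ a a' u w w' u')
    (A : (Fin d × Bool) → Fin 3 ⊕ Unit → Fin 3 ⊕ Unit → Site d → Site d → Site d → Site d → ℝ≥0∞)
    (PE : Fin 3 ⊕ Unit → Site d → Site d → ℝ≥0∞)
    (h2 : ∀ (a : Fin (M + 2) → Fin 3 ⊕ Unit) (c : Fin 3 ⊕ Unit) (b : Fin (M + 2) → Site d × Site d)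
      (w t z : Fin (M + 2) → Site d), PivAdm (M + 1) b →
      (∏ i, ENNReal.ofReal (bondJ d p ((b i).2 - (b i).1))) *
          piPerc d p (M + 3) (jwCoverE M x b w t z ∩ jwCoverC M x b w t z a c) ≤
        ∑ κ : Fin (M + 2) → Fin d × Bool, dirInd stepVec κ b *
          (S (a 0) (b 0).1 (w 0) * chainTail Bpt A PE x (M + 1) κ a c b w t z)) :
    nobleXiT d p (M + 2) x ≤ ∑' u, ∑' w, ∑' t, ∑' z, ∑ κ : Fin d × Bool, ∑ a : Fin 3 ⊕ Unit, ∑ c : Fin 3 ⊕ Unit,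
      recP S B (M + 1) a u w * A κ a c u w t z * PE c (t - x) (z - x) :=
  nobleXiT_le_recP_chain_of_cover p x (M + 1) S B Bpt hBpt A PE (jwCoverEAdm M x) (jwCoverC M x)
    (jwCoverEAdm_subset_iUnion_jwCoverC M x) (nobleXiT_succ_succ_le_jwCoverEAdm p M x)
    fun a c b w t z => mul_piPerc_jwCoverEAdm_inter_le p M x b w t z (jwCoverC M x b w t z a c) (h2 a c b w t z)

/-! ### E. Junction form: the next pivotal bond is not the reversed exit bond -/

/-- On a level of kind `≠ zero` the vacancy clause separates the adjoined vertex from the end vertex `b̲_i`.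
[cite: FitznerVanDerHofstad2017, (4.58)–(4.61) "`b̲_{i-1} ∉ {…, b̲_i}`" (arXiv:1506.07977v2 p. 41)] -/
theorem LvView.u_ne_y_of_vac (V : LvView d) (hk : V.kd ≠ .zero) (h : V.Vac) : V.u ≠ V.y := by
  obtain ⟨kd, u, v, t', z', y, y', w', z'', off⟩ := V
  cases kd <;> simp_all [LvView.Vac]

/-- **(O1) of the K2 design, parameter form.**  Under pivotal admissibility and the vacancy `b̲_{k+1} ≠ b̲_k`, the
pivotal bond `b_{k+1}` differs from the exit bond `{b̲_k, w_k}` of level `k` (so the two may be inserted on level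
`k + 1` as distinct bonds). [cite: FitznerVanDerHofstad2017, (3.25)–(3.27) and (4.58)–(4.61) (arXiv:1506.07977v2 pp. 25–26, 41)] -/
theorem PivAdm.bond_succ_ne_exit {M : ℕ} {b : Fin (M + 2) → Site d × Site d} (h : PivAdm (M + 1) b)
    (w : Fin (M + 2) → Site d) (k : Fin (M + 1)) (hu : (b k.succ).1 ≠ (b k.castSucc).1) :
    s((b k.succ).1, (b k.succ).2) ≠ s((b k.castSucc).1, w k.castSucc) := by
  intro he
  rw [Sym2.eq_iff] at he
  rcases he with ⟨h1, -⟩ | ⟨-, h2⟩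
  · exact hu h1
  · exact h k h2

section Piece

variable {M : ℕ} {x : Site d} {b : Fin (M + 2) → Site d × Site d} {w t z : Fin (M + 2) → Site d}
  {a : Fin (M + 2) → Fin 3 ⊕ Unit} {c : Fin 3 ⊕ Unit} {τ : Fin (M + 1) → Bool × Fin 3}

/-- The vacancy `b̲_{k+1} ≠ b̲_k` on a variant piece (slot form of `LvView.Vac` of level `k + 1`).
[cite: FitznerVanDerHofstad2017, (4.58)–(4.61) (arXiv:1506.07977v2 p. 41)] -/
theorem fst_succ_ne_fst_of_mem_jwPiece {ω : Fin (M + 3) → BondConfig (Site d)}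
    (hω : ω ∈ jwPiece M x b w t z a c τ) (k : Fin (M + 1)) : (b k.succ).1 ≠ (b k.castSucc).1 := by
  have hW := hω.2.2.1
  have hvac := (level_of_mem_jointWitN hW k.castSucc.succ).2.1
  have hkd : ((topParams (M + 1) (clsS M a) (sigOf M τ) b w t z x).topViews k.castSucc.succ).kd ≠ .zero :=
    kd_succ_ne_zero (x := x) (b := b) (w := w) (t := t) (z := z) (a := a) (τ := τ) k.castSucc
  have hne := LvView.u_ne_y_of_vac _ hkd hvac
  rw [ChainParams.topViews_castSucc_succ] at hne
  simpa [ChainParams.midView, topParams] using hne.symm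

/-- **(O1) on a variant piece**: under pivotal admissibility, `b_{k+1} ≠ {b̲_k, w_k}`.
[cite: FitznerVanDerHofstad2017, (3.25)–(3.27), (4.58)–(4.61) (arXiv:1506.07977v2 pp. 25–26, 41)] -/
theorem bond_succ_ne_exit_of_mem_jwPiece {ω : Fin (M + 3) → BondConfig (Site d)}
    (hω : ω ∈ jwPiece M x b w t z a c τ) (hA : PivAdm (M + 1) b) (k : Fin (M + 1)) :
    s((b k.succ).1, (b k.succ).2) ≠ s((b k.castSucc).1, w k.castSucc) :=
  hA.bond_succ_ne_exit w k (fst_succ_ne_fst_of_mem_jwPiece hω k)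

/-- **The NoBLE memory of the next pivotal bond on a variant piece**: under pivotal admissibility,
`b_{k+1} ∉ B(b̲_k)` — the pivotal bond closing level `k + 1` is not one of the bonds made vacant on that level.
[cite: FitznerVanDerHofstad2017, (3.25)–(3.27), (3.31) "level j ≥ 1 is (B, A′) = (B(b̲_{j-1}), {b̲_{j-1}})" (arXiv:1506.07977v2 pp. 25–27)] -/
theorem bond_succ_notMem_bondsAt_of_mem_jwPiece {ω : Fin (M + 3) → BondConfig (Site d)}
    (hω : ω ∈ jwPiece M x b w t z a c τ) (hA : PivAdm (M + 1) b) (k : Fin (M + 1)) :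
    s((b k.succ).1, (b k.succ).2) ∉ bondsAt ({(b k.castSucc).1} : Set (Site d)) := by
  rw [mem_bondsAt_singleton_iff, Sym2.mem_iff, not_or]
  exact ⟨(fst_succ_ne_fst_of_mem_jwPiece hω k).symm, (hA k).symm⟩

end Piece

end Literature.Probability.FitznerVanDerHofstad2017

end
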